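import Literature.NumberTheory.GaloisCohomology.KolyvaginSystems
import HarnessLib

/-!
# Kolyvagin systems of rank `0` (Sakamoto): the index set `M`, the structures `𝓕^𝔮(d)`, the module
# `KS₀(T, 𝓕)`, the elements `δ(κ)_d`, residually self-dual Selmer structures — vocabulary with
# proved API (companion of `KolyvaginSystems.lean`; Sakamoto JTNB 36 (2024) §8 = JTNB 33 (2021) §5)

Topic `NumberTheory/GaloisCohomology`, next to `KolyvaginSystems.lean` (whose `KolyvaginDatum`,
`KS₁ = KolyvaginDatum.kolyvaginSystems`, `v_𝔮 = singularLocalization`, `φ^{fs}_𝔮 ∘ loc_𝔮 =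
fsLocalization`, `𝓕^a_b(c) = SelmerStructure.modify`, `dualTransported`, `IsResiduallyCoisotropicAt`
it extends).  Definitions with bodies and proved lemmas only; nothing is asserted.  The named facts
(Sakamoto 2024 Thm. 8.5 (2)–(3) for `R = ℤ/3^m`, `K = ℚ`) live in the sibling
`Sakamoto2024KolyvaginRankZero.lean`.  Typing layer `bsd-littype` (seat 10, gen 2).

## Sources, verbatim (read 2026-08-26 on the publishers' OA PDFs)

[S24] R. Sakamoto, *The theory of Kolyvagin systems for `p = 3`*, J. Théor. Nombres Bordeaux **36**
(2024) 919–946, §8 "Kolyvagin systems of rank 0", p. 937: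

> "In order to define rank 0 Kolyvagin systems, we fix an `R`-isomorphism `H¹_{/ur}(K_𝔮, T) ≅ R`
> for each prime `𝔮 ∈ 𝒫` (see the isomorphism that appears at the beginning of Section 4). Then we
> obtain a pair of `R`-homomorphisms `v_𝔮 : H¹(K, T) → H¹_{/ur}(K_𝔮, T) ≅ R`,
> `φ^{fs}_𝔮 : H¹(K, T) → H¹_{/ur}(K_𝔮, T) ⊗_ℤ G_𝔮 ≅ R ⊗_ℤ G_𝔮` (see the homomorphisms that appears
> just before Definition 4.1).
> **Definition 8.1** ([24, Definition 5.1]). We set `M := {(d, 𝔮) ∈ 𝒩 × 𝒫 | 𝔮 ∤ d}`. A Kolyvagin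
> system of rank 0 is an element `(κ_{d,𝔮})_{(d,𝔮) ∈ M} ∈ ∏_{(d,𝔮) ∈ M} H¹_{𝓕^𝔮(d)}(K, T) ⊗_ℤ G_d`
> satisfying the following relations for any elements `(d, 𝔮), (d, 𝔯), (d𝔮, 𝔯) ∈ M`:
> `v_𝔮(κ_{d𝔮,𝔯}) = φ^{fs}_𝔮(κ_{d,𝔯})`, `v_𝔯(κ_{d𝔮,𝔯}) = −φ^{fs}_𝔮(κ_{d,𝔮})`,
> `v_𝔮(κ_{1,𝔮}) = v_𝔯(κ_{1,𝔯})`.  We write `KS₀(T, 𝓕)` for the module of Kolyvagin systems of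
> rank 0. For any Kolyvagin system `κ := (κ_{d,𝔮})_{(d,𝔮)∈M} ∈ KS₀(T, 𝓕)` and square-free ideal
> `d ∈ 𝒩`, we put `δ(κ)_d := v_𝔮(κ_{d,𝔮}) ∈ R ⊗_ℤ G_d`. Note that `δ(κ)_d` does not depend on the
> choice of the prime `𝔮 ∈ 𝒫` with `𝔮 ∤ d`.
> **Definition 8.2.** We say that the Selmer structure `𝓕` is residually self-dual if `𝓕̄ = 𝓕̄^*`,
> that is, `H¹_𝓕(K_𝔮, T̄) = H¹_{𝓕^*}(K_𝔮, T̄)` for any prime `𝔮 ∈ S(𝓕)`.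
> **Remark 8.3.** If `𝓕` is residually self-dual, then `χ(𝓕) = 0` by definition."

and §4, p. 925: "`φ^{fs}_𝔮 : H¹(K,T) →^{loc_𝔮} H¹(K_𝔮,T) →^{pr_ur} H¹_ur(K_𝔮,T) →^{φ^{fs}_𝔮}
H¹_{/ur}(K_𝔮,T) ⊗_ℤ G_𝔮`. Here `pr_ur : H¹(K_𝔮,T) → H¹_ur(K_𝔮,T)` is the projection map with
respect to the decomposition `H¹(K_𝔮,T) = H¹_ur(K_𝔮,T) ⊕ H¹_tr(K_𝔮,T)`."

[S21] R. Sakamoto, *On the theory of Kolyvagin systems of rank 0*, J. Théor. Nombres Bordeaux **33**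
(2021) 1077–1102 (= [24] of [S24]), §5: Def. 5.1 (relations (5.1)–(5.3) as above, p. 1089);
**Remark 5.3**: "The relation (5.2) depends on the choice of the fixed isomorphism
`H¹_{/ur}(G_{k_q}, T) ≅ R` for each prime `q ∈ 𝒫_n(T)`. Hence the module `KS₀(T, 𝓕, Q)` also
depends on these fixed isomorphisms."; p. 1089: "By the relation (5.1), for a system
`{κ_{n,q}}_{(n,q)∈M(Q)} ∈ KS₀(T, 𝓕, Q)`, we have `{κ_{n,q′}}_{n∈𝒩(Q∖{q′})} ∈ KS₁(T, 𝓕^{q′}, Q∖{q′})`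
for each prime `q′`. Hence we have a natural homomorphism
`KS₀(T,𝓕,Q) ↪ ∏_{q∈Q} KS₁(T,𝓕^q,Q∖{q})`."; **Def. 5.7** (p. 1093): "`δ_n(κ) := v_q(κ_{n,q}) ∈
R ⊗_ℤ G_n`. By the relations (5.2) and (5.3), the element `δ_n(κ)` does not depend on the choice of
the prime `q ∈ Q`. We fix a generator of `G_q` for each prime `q ∈ Q` and identify `R ⊗_ℤ G_n` with
`R` for each ideal `n ∈ 𝒩(Q)`."

## What is defined (all with bodies), and the conventions

* `LocalInvariants.IsResiduallySelfDualAt / IsResiduallySelfDual` — Def. 8.2 on the residual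
  structure `𝓖 = 𝓕̄`, the dual transported to `T̄` by the (H.SD) datum `θ` exactly as in the tree's
  `IsResiduallyCoisotropicAt` (`dualTransported inv 𝓖 θ v = 𝓖 v`); proved: self-dual ⟹
  coisotropic (Def. 3.8), and `E(𝓕) = ∅` (Def. 3.9).
* `KolyvaginDatum.IsPair D d 𝔮` — the index set `M = {(d, 𝔮) ∈ 𝒩 × 𝒫 | 𝔮 ∤ d}` (+ closure lemmas);
  `KolyvaginDatum.atPair D 𝓕 d 𝔮 = 𝓕^𝔮(d)` (relaxed at `𝔮`, the transverse conditions of the datum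
  at `d`; Def. 3.3), with unfolding lemmas and `atPair_eq_atLevel_relaxedAt : 𝓕^𝔮(d) = (𝓕^𝔮)(d)`.
* `KolyvaginDatum.VanishesOnTransverse D` — the slot `D.fs 𝔮` kills `H¹_tr(K_𝔮, T)` at every
  `𝔮 ∈ 𝒫`: Sakamoto's `φ^{fs}_𝔮` on `H¹(K_𝔮, T)` is `φ^{fs}_𝔮 ∘ pr_ur` (§4, p. 925).  In `KS₁` the
  slot only meets classes unramified at `𝔮`; relation (5.2) of `KS₀` applies `φ^{fs}_𝔮` to
  `κ_{d,𝔮}`, which is RELAXED at `𝔮`, so the behaviour of the slot on `H¹_tr` matters and is pinned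
  by this predicate (next to `KolyvaginDatum.HasCanonicalComparison` on `H¹_ur`).
* The trivialisations "`H¹_{/ur}(K_𝔮, T) ≅ R`" are DATA ([S21] Rem. 5.3): a family
  `t 𝔮 : H¹_{/ur}(K_𝔮, T) →+ ℤ/N` over the finite places (used at `𝔮 ∈ 𝒫`; bijectivity there is a
  hypothesis of the consumer).  As in `KolyvaginSystems.lean` no coefficient ring is carried
  (`R = ℤ/N` acts through `ℤ`) and the `⊗ G_d` are trivialised by fixed generators (Kim, AJM 148
  §2.2.2; [S21] Def. 5.7 "identify `R ⊗_ℤ G_n` with `R`").  TODO(general form): `R = 𝒪/π^m`.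
* `KolyvaginDatum.IsKolyvaginSystemZero D N t 𝓕 κ` / `kolyvaginSystemsZero D N t 𝓕 = KS₀(T, 𝓕)`
  (Def. 8.1 = [S21] Def. 5.1): `κ : (d, 𝔮) ↦ κ_{d,𝔮}`, a function of all pairs vanishing off `M`,
  with `κ_{d,𝔮} ∈ H¹_{𝓕^𝔮(d)}(K, T)` and the three relations; (5.1) is stated in `H¹_{/ur}(K_𝔮, T)`
  itself (both sides live at the same prime), (5.2) and (5.3) through `t`.
* `KolyvaginDatum.erasePrime D 𝔮` (`𝒫 ∖ {𝔮}`) and the PROVED restriction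
  `IsKolyvaginSystemZero.isKolyvaginSystem_erasePrime : (κ_{d,𝔮})_d ∈ KS₁(T, 𝓕^𝔮, 𝒫 ∖ {𝔮})`
  ([S21] p. 1089), packaged as the homomorphism `kolyvaginSystemsZero.toRankOne`.
* `KolyvaginDatum.delta D N t κ d = δ(κ)_d ∈ ℤ/N`, the PROVED independence of the auxiliary prime
  (`IsKolyvaginSystemZero.trivialised_singularLocalization_eq`, from (5.2) and (5.3) as printed),
  `delta_eq`, and the homomorphisms `deltaHom d : KS₀(T, 𝓕) →+ ℤ/N`.
* Pure algebra (proved): `KolyvaginSystem.idealOfElement_self : I_S(x) = (x)` for `x ∈ S` in the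
  free rank-one module `S` (Def. 4.2) — the unfolding of `I_R(δ(κ)_d)` in Thm. 8.5 (3).
Not here: Stark systems `SS₀` and the regulator `Reg₀` ([S21] §3–§5.2), Remark 8.3 / Lemma 8.4 as
theorems (they rest on Lemma 3.7, not in the tree).

References: [Sakamoto2024] §8, Defs. 8.1, 8.2, Rem. 8.3 (p. 937), §4 (p. 925), Def. 3.3 (p. 922),
Def. 4.2 (p. 926); [Sakamoto2021RankZero] Def. 5.1, Rem. 5.2–5.3 (pp. 1088–1089), Def. 5.7
(p. 1093); [Kim2022StructureSelmer] §2.2.2; [Rubin2011] Def. 2.2.1.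
-/

noncomputable section

open scoped Classical NumberField ContRepresentation
open Function Field NumberField IsDedekindDomain
open Literature.NumberTheory.GaloisRepresentations Literature.NumberTheory.GaloisRepresentations.DiscreteGaloisModule
  Literature.NumberTheory.GaloisCohomology

universe u

namespace Literature.NumberTheory.GaloisCohomology

variable {K : Type u} [Field K] [NumberField K]

/-! ## A. Residually self-dual Selmer structures (Def. 8.2) -/

namespace LocalInvariants

variable {n : ℕ} {Mbar : Type u} [AddCommGroup Mbar] [TopologicalSpace Mbar] [DiscreteTopology Mbar]
  [Finite Mbar] {ρbar : DiscreteGaloisModule K Mbar}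

/-- **`𝓕` is residually self-dual at the place `v`** (Sakamoto Def. 8.2, for `𝓖 = 𝓕̄` the residual
structure on `T̄`): the dual condition `𝓖^*_v`, transported to `H¹(K_v, T̄)` through the (H.SD)
datum `θ : T̄ → T̄^∨(1)` (`dualTransported`, as in `IsResiduallyCoisotropicAt`), EQUALS `𝓖_v`
("`H¹_𝓕(K_𝔮, T̄) = H¹_{𝓕^*}(K_𝔮, T̄)`"). [cite: Sakamoto2024, Def. 8.2 (p. 937)] -/
def IsResiduallySelfDualAt (inv : LocalInvariants K n) (𝓖 : SelmerStructure ρbar)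
    (θ : ρbar.toContRepresentation →ⁱL (ρbar.tateDual n).toContRepresentation) (v : Place K) :
    Prop :=
  inv.dualTransported 𝓖 θ v = 𝓖 v

/-- **`𝓕` is residually self-dual** on the finite set `S = S(𝓕)` ("`𝓕̄ = 𝓕̄^*`, that is,
`H¹_𝓕(K_𝔮, T̄) = H¹_{𝓕^*}(K_𝔮, T̄)` for any prime `𝔮 ∈ S(𝓕)`"): self-dual at every `v ∈ S`.
[cite: Sakamoto2024, Def. 8.2 (p. 937)] -/
def IsResiduallySelfDual (inv : LocalInvariants K n) (𝓖 : SelmerStructure ρbar)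
    (θ : ρbar.toContRepresentation →ⁱL (ρbar.tateDual n).toContRepresentation)
    (S : Finset (Place K)) : Prop :=
  ∀ v ∈ S, inv.IsResiduallySelfDualAt 𝓖 θ v

/-- A residually self-dual structure is residually coisotropic at the same place
(`𝓕̄^* = 𝓕̄` gives `𝓕̄^* < 𝓕̄`, Def. 3.8). [cite: Sakamoto2024, Def. 8.2 (p. 937) and Def. 3.8 (p. 924)] -/
theorem IsResiduallySelfDualAt.isResiduallyCoisotropicAt {inv : LocalInvariants K n}
    {𝓖 : SelmerStructure ρbar}
    {θ : ρbar.toContRepresentation →ⁱL (ρbar.tateDual n).toContRepresentation} {v : Place K}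
    (h : inv.IsResiduallySelfDualAt 𝓖 θ v) : inv.IsResiduallyCoisotropicAt 𝓖 θ v :=
  le_of_eq h

/-- A residually self-dual structure is residually coisotropic (Def. 3.8).
[cite: Sakamoto2024, Def. 8.2 (p. 937) and Def. 3.8 (p. 924)] -/
theorem IsResiduallySelfDual.isResiduallyCoisotropic {inv : LocalInvariants K n}
    {𝓖 : SelmerStructure ρbar}
    {θ : ρbar.toContRepresentation →ⁱL (ρbar.tateDual n).toContRepresentation}
    {S : Finset (Place K)} (h : inv.IsResiduallySelfDual 𝓖 θ S) :
    inv.IsResiduallyCoisotropic 𝓖 θ S :=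
  fun v hv => (h v hv).isResiduallyCoisotropicAt

/-- For a residually self-dual structure the exceptional set `E(𝓕) = {𝔮 ∈ S(𝓕) : H¹_𝓕̄ ≠ H¹_{𝓕̄^*}}`
of Def. 3.9 is empty. [cite: Sakamoto2024, Def. 8.2 (p. 937) and Def. 3.9 (p. 924)] -/
theorem IsResiduallySelfDual.exceptionalSet_eq_empty {inv : LocalInvariants K n}
    {𝓖 : SelmerStructure ρbar}
    {θ : ρbar.toContRepresentation →ⁱL (ρbar.tateDual n).toContRepresentation}
    {S : Finset (Place K)} (h : inv.IsResiduallySelfDual 𝓖 θ S) :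
    inv.exceptionalSet 𝓖 θ S = ∅ := by
  ext v
  simp only [mem_exceptionalSet_iff, Finset.notMem_empty, iff_false, not_and, not_not]
  exact fun hv => (h v hv).symm

end LocalInvariants

/-! ## B. The index set `M`, the structures `𝓕^𝔮(d)`, and the convention `φ^{fs}_𝔮 ∘ pr_ur` -/

namespace KolyvaginDatum

variable {M : Type u} [AddCommGroup M] [TopologicalSpace M] [DiscreteTopology M]
  {ρ : DiscreteGaloisModule K M}

/-- The index set **`M := {(d, 𝔮) ∈ 𝒩 × 𝒫 | 𝔮 ∤ d}`** of Def. 8.1: `d` a level, `𝔮` a Kolyvagin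
prime not in `d`. [cite: Sakamoto2024, Def. 8.1 (p. 937)] -/
def IsPair (D : KolyvaginDatum ρ) (d : Finset (HeightOneSpectrum (𝓞 K)))
    (q : HeightOneSpectrum (𝓞 K)) : Prop :=
  D.IsLevel d ∧ q ∈ D.primes ∧ q ∉ d

/-- `(d, 𝔮) ∈ M` gives `d ∈ 𝒩`. [cite: Sakamoto2024, Def. 8.1 (p. 937)] -/
theorem IsPair.isLevel {D : KolyvaginDatum ρ} {d : Finset (HeightOneSpectrum (𝓞 K))}
    {q : HeightOneSpectrum (𝓞 K)} (h : D.IsPair d q) : D.IsLevel d :=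
  h.1

/-- `(d, 𝔮) ∈ M` gives `𝔮 ∈ 𝒫`. [cite: Sakamoto2024, Def. 8.1 (p. 937)] -/
theorem IsPair.mem_primes {D : KolyvaginDatum ρ} {d : Finset (HeightOneSpectrum (𝓞 K))}
    {q : HeightOneSpectrum (𝓞 K)} (h : D.IsPair d q) : q ∈ D.primes :=
  h.2.1

/-- `(d, 𝔮) ∈ M` gives `𝔮 ∤ d`. [cite: Sakamoto2024, Def. 8.1 (p. 937)] -/
theorem IsPair.not_mem {D : KolyvaginDatum ρ} {d : Finset (HeightOneSpectrum (𝓞 K))}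
    {q : HeightOneSpectrum (𝓞 K)} (h : D.IsPair d q) : q ∉ d :=
  h.2.2

/-- `(d, 𝔮) ∈ M` gives `d𝔮 ∈ 𝒩`. [cite: Sakamoto2024, Def. 8.1 (p. 937)] -/
theorem IsPair.isLevel_insert {D : KolyvaginDatum ρ} {d : Finset (HeightOneSpectrum (𝓞 K))}
    {q : HeightOneSpectrum (𝓞 K)} (h : D.IsPair d q) : D.IsLevel (insert q d) :=
  h.1.insert h.2.1

/-- `(d, 𝔮), (d, 𝔯) ∈ M` with `𝔮 ≠ 𝔯` give `(d𝔮, 𝔯) ∈ M` — the third index of the relations of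
Def. 8.1. [cite: Sakamoto2024, Def. 8.1 (p. 937)] -/
theorem IsPair.insert {D : KolyvaginDatum ρ} {d : Finset (HeightOneSpectrum (𝓞 K))}
    {q r : HeightOneSpectrum (𝓞 K)} (hq : D.IsPair d q) (hr : D.IsPair d r) (hqr : q ≠ r) :
    D.IsPair (insert q d) r :=
  ⟨hq.isLevel_insert, hr.mem_primes, by simp [hr.not_mem, Ne.symm hqr]⟩

/-- `(1, 𝔮) ∈ M` for every `𝔮 ∈ 𝒫`. [cite: Sakamoto2024, Def. 8.1 (p. 937)] -/
theorem isPair_empty {D : KolyvaginDatum ρ} {q : HeightOneSpectrum (𝓞 K)} (hq : q ∈ D.primes) :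
    D.IsPair ∅ q :=
  ⟨D.isLevel_empty, hq, by simp⟩

/-- Removing a prime from a pair: `(d, 𝔮) ∈ M`, `𝔰 ∣ d` give `(d/𝔰, 𝔰) ∈ M`.
[cite: Sakamoto2024, Def. 8.1 (p. 937)] -/
theorem IsPair.erase {D : KolyvaginDatum ρ} {d : Finset (HeightOneSpectrum (𝓞 K))}
    {q : HeightOneSpectrum (𝓞 K)} (h : D.IsPair d q) {s : HeightOneSpectrum (𝓞 K)} (hs : s ∈ d) :
    D.IsPair (d.erase s) s :=
  ⟨fun _ hx => h.1 (Finset.mem_of_mem_erase (Finset.mem_coe.mp hx)), h.1 (Finset.mem_coe.mpr hs),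
    Finset.notMem_erase s d⟩

/-- Removing a prime from a pair keeps the auxiliary prime admissible: `(d, 𝔮) ∈ M`, `𝔰 ∣ d` give
`(d/𝔰, 𝔮) ∈ M`. [cite: Sakamoto2024, Def. 8.1 (p. 937)] -/
theorem IsPair.erase_left {D : KolyvaginDatum ρ} {d : Finset (HeightOneSpectrum (𝓞 K))}
    {q : HeightOneSpectrum (𝓞 K)} (h : D.IsPair d q) (s : HeightOneSpectrum (𝓞 K)) :
    D.IsPair (d.erase s) q :=
  ⟨fun _ hx => h.1 (Finset.mem_of_mem_erase (Finset.mem_coe.mp hx)), h.mem_primes,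
    fun hq => h.not_mem (Finset.mem_of_mem_erase hq)⟩

/-- **`𝓕^𝔮(d)`**: the structure `𝓕` relaxed at `𝔮` and carrying the transverse conditions of the
datum at the places of `d` (Def. 3.3 with `a = 𝔮`, `b = 1`, `c = d`) — the local conditions of the
component `κ_{d,𝔮} ∈ H¹_{𝓕^𝔮(d)}(K, T)` of a rank-zero Kolyvagin system.
[cite: Sakamoto2024, Def. 3.3 (p. 922) and Def. 8.1 (p. 937)] -/
abbrev atPair (D : KolyvaginDatum ρ) (𝓕 : SelmerStructure ρ) (d : Finset (HeightOneSpectrum (𝓞 K)))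
    (q : HeightOneSpectrum (𝓞 K)) : SelmerStructure ρ :=
  𝓕.modify D.transverse {q} ∅ d

/-- `𝓕^𝔮(d)` at the relaxed prime `𝔮` is everything. [cite: Sakamoto2024, Def. 3.3 (p. 922)] -/
@[simp] theorem atPair_inr_self (D : KolyvaginDatum ρ) (𝓕 : SelmerStructure ρ)
    (d : Finset (HeightOneSpectrum (𝓞 K))) (q : HeightOneSpectrum (𝓞 K)) :
    D.atPair 𝓕 d q (Sum.inr q) = ⊤ :=
  SelmerStructure.modify_inr_of_mem_relaxed _ _ (Finset.mem_singleton_self q)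

/-- `𝓕^𝔮(d)` at a prime `𝔰 ∣ d`, `𝔰 ≠ 𝔮`, is the transverse condition.
[cite: Sakamoto2024, Def. 3.3 (p. 922)] -/
theorem atPair_inr_of_mem (D : KolyvaginDatum ρ) (𝓕 : SelmerStructure ρ)
    {d : Finset (HeightOneSpectrum (𝓞 K))} {q s : HeightOneSpectrum (𝓞 K)} (hsq : s ≠ q)
    (hs : s ∈ d) : D.atPair 𝓕 d q (Sum.inr s) = D.transverse (Sum.inr s) :=
  SelmerStructure.modify_inr_of_mem_transverse _ _ (by simpa using hsq) (by simp) hs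

/-- `𝓕^𝔮(d)` away from `𝔮` and `d` is `𝓕`. [cite: Sakamoto2024, Def. 3.3 (p. 922)] -/
theorem atPair_inr_of_not_mem (D : KolyvaginDatum ρ) (𝓕 : SelmerStructure ρ)
    {d : Finset (HeightOneSpectrum (𝓞 K))} {q s : HeightOneSpectrum (𝓞 K)} (hsq : s ≠ q)
    (hs : s ∉ d) : D.atPair 𝓕 d q (Sum.inr s) = 𝓕 (Sum.inr s) :=
  SelmerStructure.modify_inr_of_not_mem _ _ (by simpa using hsq) (by simp) hs

/-- `𝓕^𝔮(d)` does not touch the infinite places. [cite: Sakamoto2024, Def. 3.3 (p. 922)] -/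
@[simp] theorem atPair_inl (D : KolyvaginDatum ρ) (𝓕 : SelmerStructure ρ)
    (d : Finset (HeightOneSpectrum (𝓞 K))) (q : HeightOneSpectrum (𝓞 K)) (w : InfinitePlace K) :
    D.atPair 𝓕 d q (Sum.inl w) = 𝓕 (Sum.inl w) := rfl

/-- For `𝔮 ∤ d`, **`𝓕^𝔮(d) = (𝓕^𝔮)(d)`**: relaxing at `𝔮` and imposing the transverse conditions at
`d` commute — so the `𝔮`-components `(κ_{d,𝔮})_d` of a rank-zero system live in the vertices of the
rank-one theory for the relaxed structure `𝓕^𝔮` ([S21] p. 1089).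
[cite: Sakamoto2024, Def. 3.3 (p. 922)] [cite: Sakamoto2021RankZero, §5.1 (p. 1089)] -/
theorem atPair_eq_atLevel_relaxedAt (D : KolyvaginDatum ρ) (𝓕 : SelmerStructure ρ)
    {d : Finset (HeightOneSpectrum (𝓞 K))} {q : HeightOneSpectrum (𝓞 K)} (hq : q ∉ d) :
    D.atPair 𝓕 d q = D.atLevel (𝓕.relaxedAt {q}) d := by
  funext v
  cases v with
  | inl w => rfl
  | inr s =>
    by_cases hsq : s = q
    · subst hsq
      simp [hq]
    · by_cases hs : s ∈ d
      · simp [hsq, hs]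
      · simp [hsq, hs]

/-- **The comparison slot factors through `pr_ur`**: at every Kolyvagin prime `𝔮 ∈ 𝒫` the map
`D.fs 𝔮 : H¹(K_𝔮, T) → H¹_{/ur}(K_𝔮, T)` vanishes on the transverse subgroup `H¹_tr(K_𝔮, T)` of the
datum.  This is Sakamoto's convention for `φ^{fs}_𝔮` on all of `H¹(K_𝔮, T)`: "`φ^{fs}_𝔮 : H¹(K,T)
→^{loc_𝔮} H¹(K_𝔮,T) →^{pr_ur} H¹_ur(K_𝔮,T) →^{φ^{fs}_𝔮} H¹_{/ur}(K_𝔮,T) ⊗_ℤ G_𝔮`. Here `pr_ur` is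
the projection map with respect to the decomposition `H¹(K_𝔮,T) = H¹_ur(K_𝔮,T) ⊕ H¹_tr(K_𝔮,T)`"
— so `φ^{fs}_𝔮` kills `H¹_tr`.  (The rank-one relation only evaluates the slot on classes
unramified at `𝔮`; relation (5.2) of `KS₀` evaluates it on `κ_{d,𝔮}`, relaxed at `𝔮`.)
[cite: Sakamoto2024, §4 (p. 925), the maps `φ^{fs}_q` and `pr_ur`] -/
def VanishesOnTransverse (D : KolyvaginDatum ρ) : Prop :=
  ∀ q ∈ D.primes, ∀ x ∈ D.transverse (Sum.inr q), D.fs q x = 0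

/-! ## C. Kolyvagin systems of rank `0` (Def. 8.1) -/

/-- **Kolyvagin systems of rank `0` for `(T, 𝓕, 𝒫)`** relative to the datum `D` and the
trivialisations `t = (t_𝔮 : H¹_{/ur}(K_𝔮, T) → ℤ/N)_𝔮` of the singular quotients (Sakamoto
Def. 8.1 = [S21] Def. 5.1; generator-fixed convention, no `⊗ G_d`): a family
`κ = (κ_{d,𝔮})_{(d,𝔮) ∈ M}` — here a function of all pairs, required to VANISH off `M` — with
* `κ_{d,𝔮} ∈ H¹_{𝓕^𝔮(d)}(K, T)` for every `(d, 𝔮) ∈ M`;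
* (5.1) `v_𝔮(κ_{d𝔮,𝔯}) = φ^{fs}_𝔮(κ_{d,𝔯})` in `H¹_{/ur}(K_𝔮, T)`,
* (5.2) `v_𝔯(κ_{d𝔮,𝔯}) = −φ^{fs}_𝔮(κ_{d,𝔮})` in `R` (through `t_𝔯` and `t_𝔮`),
for all `(d, 𝔮), (d, 𝔯), (d𝔮, 𝔯) ∈ M` (i.e. `𝔮 ≠ 𝔯` Kolyvagin primes outside the level `d`), and
* (5.3) `v_𝔮(κ_{1,𝔮}) = v_𝔯(κ_{1,𝔯})` in `R` for all `𝔮, 𝔯 ∈ 𝒫`.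
[cite: Sakamoto2024, Def. 8.1 (p. 937)] [cite: Sakamoto2021RankZero, Def. 5.1 (pp. 1088–1089)] -/
structure IsKolyvaginSystemZero (D : KolyvaginDatum ρ) (N : ℕ)
    (t : (q : HeightOneSpectrum (𝓞 K)) → SingularQuotient (GaloisRep.toLocal q ρ) →+ ZMod N)
    (𝓕 : SelmerStructure ρ)
    (κ : Finset (HeightOneSpectrum (𝓞 K)) → HeightOneSpectrum (𝓞 K) → galoisCohomology ρ 1) :
    Prop where
  /-- `κ` is supported on `M = {(d, 𝔮) : d ⊆ 𝒫, 𝔮 ∈ 𝒫 ∖ d}`. -/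
  eq_zero_of_not_isPair : ∀ d q, ¬ D.IsPair d q → κ d q = 0
  /-- `κ_{d,𝔮} ∈ H¹_{𝓕^𝔮(d)}(K, T)`. -/
  mem_selmerGroup : ∀ d q, D.IsPair d q → κ d q ∈ (D.atPair 𝓕 d q).selmerGroup
  /-- (5.1) `v_𝔮(κ_{d𝔮,𝔯}) = φ^{fs}_𝔮(κ_{d,𝔯})`. -/
  rel₁ : ∀ d q r, D.IsPair d q → D.IsPair d r → q ≠ r →
    singularLocalization ρ q (κ (insert q d) r) = D.fsLocalization q (κ d r)
  /-- (5.2) `v_𝔯(κ_{d𝔮,𝔯}) = −φ^{fs}_𝔮(κ_{d,𝔮})`. -/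
  rel₂ : ∀ d q r, D.IsPair d q → D.IsPair d r → q ≠ r →
    t r (singularLocalization ρ r (κ (insert q d) r)) = -t q (D.fsLocalization q (κ d q))
  /-- (5.3) `v_𝔮(κ_{1,𝔮}) = v_𝔯(κ_{1,𝔯})`. -/
  rel₃ : ∀ q r, q ∈ D.primes → r ∈ D.primes →
    t q (singularLocalization ρ q (κ ∅ q)) = t r (singularLocalization ρ r (κ ∅ r))

/-- **The group `KS₀(T, 𝓕)` of Kolyvagin systems of rank `0`** (an `R = ℤ/N`-module through the
`ℤ`-action; "We write `KS₀(T, 𝓕)` for the module of Kolyvagin systems of rank 0").  It depends on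
the trivialisations `t` ([S21] Rem. 5.3).
[cite: Sakamoto2024, Def. 8.1 (p. 937)] [cite: Sakamoto2021RankZero, Def. 5.1 and Rem. 5.3 (p. 1089)] -/
def kolyvaginSystemsZero (D : KolyvaginDatum ρ) (N : ℕ)
    (t : (q : HeightOneSpectrum (𝓞 K)) → SingularQuotient (GaloisRep.toLocal q ρ) →+ ZMod N)
    (𝓕 : SelmerStructure ρ) :
    AddSubgroup (Finset (HeightOneSpectrum (𝓞 K)) → HeightOneSpectrum (𝓞 K) → galoisCohomology ρ 1)
    where
  carrier := {κ | D.IsKolyvaginSystemZero N t 𝓕 κ}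
  zero_mem' := ⟨fun _ _ _ => rfl, fun d q _ => zero_mem _, fun d q r _ _ _ => by simp,
    fun d q r _ _ _ => by simp, fun q r _ _ => by simp⟩
  add_mem' := fun {κ κ'} hκ hκ' =>
    ⟨fun d q h => by simp [hκ.eq_zero_of_not_isPair d q h, hκ'.eq_zero_of_not_isPair d q h],
      fun d q h => add_mem (hκ.mem_selmerGroup d q h) (hκ'.mem_selmerGroup d q h),
      fun d q r hq hr hqr => by
        simp only [Pi.add_apply, map_add, hκ.rel₁ d q r hq hr hqr, hκ'.rel₁ d q r hq hr hqr],
      fun d q r hq hr hqr => by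
        simp only [Pi.add_apply, map_add, hκ.rel₂ d q r hq hr hqr, hκ'.rel₂ d q r hq hr hqr,
          neg_add],
      fun q r hq hr => by simp only [Pi.add_apply, map_add, hκ.rel₃ q r hq hr, hκ'.rel₃ q r hq hr]⟩
  neg_mem' := fun {κ} hκ =>
    ⟨fun d q h => by simp [hκ.eq_zero_of_not_isPair d q h],
      fun d q h => neg_mem (hκ.mem_selmerGroup d q h),
      fun d q r hq hr hqr => by simp only [Pi.neg_apply, map_neg, hκ.rel₁ d q r hq hr hqr],
      fun d q r hq hr hqr => by simp only [Pi.neg_apply, map_neg, hκ.rel₂ d q r hq hr hqr],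
      fun q r hq hr => by simp only [Pi.neg_apply, map_neg, hκ.rel₃ q r hq hr]⟩

/-- Membership in `KS₀(T, 𝓕)`. [cite: Sakamoto2024, Def. 8.1 (p. 937)] -/
@[simp] theorem mem_kolyvaginSystemsZero_iff (D : KolyvaginDatum ρ) (N : ℕ)
    (t : (q : HeightOneSpectrum (𝓞 K)) → SingularQuotient (GaloisRep.toLocal q ρ) →+ ZMod N)
    (𝓕 : SelmerStructure ρ)
    (κ : Finset (HeightOneSpectrum (𝓞 K)) → HeightOneSpectrum (𝓞 K) → galoisCohomology ρ 1) :
    κ ∈ D.kolyvaginSystemsZero N t 𝓕 ↔ D.IsKolyvaginSystemZero N t 𝓕 κ :=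
  Iff.rfl

/-! ## D. The `𝔮`-components form a rank-one Kolyvagin system for `𝓕^𝔮` over `𝒫 ∖ {𝔮}` ([S21] p. 1089) -/

/-- The datum with the Kolyvagin prime `𝔮` removed: primes `𝒫 ∖ {𝔮}` (Sakamoto's `Q ∖ {q}`), same
transverse conditions and comparison maps. [cite: Sakamoto2021RankZero, §5.1 (p. 1089)] -/
def erasePrime (D : KolyvaginDatum ρ) (q : HeightOneSpectrum (𝓞 K)) : KolyvaginDatum ρ where
  primes := D.primes \ {q}
  transverse := D.transverse
  fs := D.fs

/-- The primes of `D.erasePrime 𝔮`. [cite: Sakamoto2021RankZero, §5.1 (p. 1089)] -/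
@[simp] theorem erasePrime_primes (D : KolyvaginDatum ρ) (q : HeightOneSpectrum (𝓞 K)) :
    (D.erasePrime q).primes = D.primes \ {q} := rfl

/-- Levels of `D.erasePrime 𝔮` are the levels of `D` not containing `𝔮`.
[cite: Sakamoto2021RankZero, §5.1 (p. 1089)] -/
theorem isLevel_erasePrime_iff (D : KolyvaginDatum ρ) (q : HeightOneSpectrum (𝓞 K))
    (d : Finset (HeightOneSpectrum (𝓞 K))) :
    (D.erasePrime q).IsLevel d ↔ D.IsLevel d ∧ q ∉ d := by
  simp only [IsLevel, erasePrime_primes, Set.subset_sdiff, Set.disjoint_singleton_right,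
    Finset.mem_coe]

/-- A level of `D.erasePrime 𝔮` together with `𝔮 ∈ 𝒫` is a pair `(d, 𝔮) ∈ M` of `D`.
[cite: Sakamoto2021RankZero, §5.1 (p. 1089)] -/
theorem isPair_of_isLevel_erasePrime {D : KolyvaginDatum ρ} {q : HeightOneSpectrum (𝓞 K)}
    (hq : q ∈ D.primes) {d : Finset (HeightOneSpectrum (𝓞 K))} (hd : (D.erasePrime q).IsLevel d) :
    D.IsPair d q :=
  ⟨((D.isLevel_erasePrime_iff q d).mp hd).1, hq, ((D.isLevel_erasePrime_iff q d).mp hd).2⟩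

/-- **The `𝔮`-components of a rank-zero Kolyvagin system form a rank-one Kolyvagin system for the
relaxed structure `𝓕^𝔮` over the primes `𝒫 ∖ {𝔮}`**: "By the relation (5.1), for a system
`{κ_{n,q}}_{(n,q) ∈ M(Q)} ∈ KS₀(T, 𝓕, Q)`, we have `{κ_{n,q′}}_{n ∈ 𝒩(Q∖{q′})} ∈ KS₁(T, 𝓕^{q′}, Q∖{q′})`
for each prime `q′`." — PROVED from the definitions (`𝓕^𝔮(d) = (𝓕^𝔮)(d)` for `𝔮 ∤ d`).
[cite: Sakamoto2021RankZero, §5.1 (p. 1089)] [cite: Sakamoto2024, Def. 8.1 (p. 937)] -/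
theorem IsKolyvaginSystemZero.isKolyvaginSystem_erasePrime {D : KolyvaginDatum ρ} {N : ℕ}
    {t : (q : HeightOneSpectrum (𝓞 K)) → SingularQuotient (GaloisRep.toLocal q ρ) →+ ZMod N}
    {𝓕 : SelmerStructure ρ}
    {κ : Finset (HeightOneSpectrum (𝓞 K)) → HeightOneSpectrum (𝓞 K) → galoisCohomology ρ 1}
    (hκ : D.IsKolyvaginSystemZero N t 𝓕 κ) {q : HeightOneSpectrum (𝓞 K)} (hq : q ∈ D.primes) :
    (D.erasePrime q).IsKolyvaginSystem (𝓕.relaxedAt {q}) fun d => κ d q where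
  eq_zero_of_not_isLevel d hd :=
    hκ.eq_zero_of_not_isPair d q fun h => hd ((D.isLevel_erasePrime_iff q d).mpr ⟨h.1, h.2.2⟩)
  mem_selmerGroup d hd := by
    have hp := isPair_of_isLevel_erasePrime hq hd
    have h := hκ.mem_selmerGroup d q hp
    rw [D.atPair_eq_atLevel_relaxedAt 𝓕 hp.not_mem] at h
    exact h
  fs_rel d hd r hr hrd := by
    have hp := isPair_of_isLevel_erasePrime hq hd
    rw [erasePrime_primes, Set.mem_sdiff, Set.mem_singleton_iff] at hr
    exact hκ.rel₁ d r q ⟨hp.isLevel, hr.1, hrd⟩ hp hr.2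

/-- The restriction homomorphism **`KS₀(T, 𝓕) → KS₁(T, 𝓕^𝔮, 𝒫 ∖ {𝔮})`, `κ ↦ (κ_{d,𝔮})_d`**, at a
Kolyvagin prime `𝔮` ([S21] p. 1089: "Hence we have a natural homomorphism
`KS₀(T,𝓕,Q) ↪ ∏_{q∈Q} KS₁(T,𝓕^q,Q∖{q})`").
[cite: Sakamoto2021RankZero, §5.1 (p. 1089)] -/
def kolyvaginSystemsZero.toRankOne (D : KolyvaginDatum ρ) (N : ℕ)
    (t : (q : HeightOneSpectrum (𝓞 K)) → SingularQuotient (GaloisRep.toLocal q ρ) →+ ZMod N)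
    (𝓕 : SelmerStructure ρ) {q : HeightOneSpectrum (𝓞 K)} (hq : q ∈ D.primes) :
    D.kolyvaginSystemsZero N t 𝓕 →+ (D.erasePrime q).kolyvaginSystems (𝓕.relaxedAt {q}) where
  toFun κ := ⟨fun d => κ.1 d q, (D.erasePrime q).mem_kolyvaginSystems_iff _ _ |>.mpr
    (((D.mem_kolyvaginSystemsZero_iff N t 𝓕 κ.1).mp κ.2).isKolyvaginSystem_erasePrime hq)⟩
  map_zero' := rfl
  map_add' _ _ := rfl

/-- Components of the restriction homomorphism. [cite: Sakamoto2021RankZero, §5.1 (p. 1089)] -/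
@[simp] theorem kolyvaginSystemsZero.toRankOne_apply (D : KolyvaginDatum ρ) (N : ℕ)
    (t : (q : HeightOneSpectrum (𝓞 K)) → SingularQuotient (GaloisRep.toLocal q ρ) →+ ZMod N)
    (𝓕 : SelmerStructure ρ) {q : HeightOneSpectrum (𝓞 K)} (hq : q ∈ D.primes)
    (κ : D.kolyvaginSystemsZero N t 𝓕) (d : Finset (HeightOneSpectrum (𝓞 K))) :
    (kolyvaginSystemsZero.toRankOne D N t 𝓕 hq κ).1 d = κ.1 d q := rfl

/-! ## E. The elements `δ(κ)_d` (Def. 8.1; [S21] Def. 5.7) -/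

/-- **Independence of the auxiliary prime**: for a rank-zero Kolyvagin system and pairs
`(d, 𝔮), (d, 𝔯) ∈ M`, `v_𝔮(κ_{d,𝔮}) = v_𝔯(κ_{d,𝔯})` in `R` ("Note that `δ(κ)_d` does not depend on
the choice of the prime `𝔮 ∈ 𝒫` with `𝔮 ∤ d`"; [S21] Def. 5.7: "By the relations (5.2) and (5.3),
the element `δ_n(κ)` does not depend on the choice of the prime `q`") — PROVED as printed: for
`d = 1` this is (5.3); for `𝔰 ∣ d`, relation (5.2) at `(d/𝔰, 𝔰, 𝔮)` and at `(d/𝔰, 𝔰, 𝔯)` computes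
both sides as `−φ^{fs}_𝔰(κ_{d/𝔰,𝔰})`.
[cite: Sakamoto2024, Def. 8.1 (p. 937)] [cite: Sakamoto2021RankZero, Def. 5.7 (p. 1093)] -/
theorem IsKolyvaginSystemZero.trivialised_singularLocalization_eq {D : KolyvaginDatum ρ} {N : ℕ}
    {t : (q : HeightOneSpectrum (𝓞 K)) → SingularQuotient (GaloisRep.toLocal q ρ) →+ ZMod N}
    {𝓕 : SelmerStructure ρ}
    {κ : Finset (HeightOneSpectrum (𝓞 K)) → HeightOneSpectrum (𝓞 K) → galoisCohomology ρ 1}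
    (hκ : D.IsKolyvaginSystemZero N t 𝓕 κ) {d : Finset (HeightOneSpectrum (𝓞 K))}
    {q r : HeightOneSpectrum (𝓞 K)} (hq : D.IsPair d q) (hr : D.IsPair d r) :
    t q (singularLocalization ρ q (κ d q)) = t r (singularLocalization ρ r (κ d r)) := by
  rcases d.eq_empty_or_nonempty with rfl | ⟨s, hs⟩
  · exact hκ.rel₃ q r hq.mem_primes hr.mem_primes
  · have hd : insert s (d.erase s) = d := Finset.insert_erase hs
    have hsq : s ≠ q := fun h => hq.not_mem (h ▸ hs)
    have hsr : s ≠ r := fun h => hr.not_mem (h ▸ hs)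
    have h₁ := hκ.rel₂ (d.erase s) s q (hq.erase hs) (hq.erase_left s) hsq
    have h₂ := hκ.rel₂ (d.erase s) s r (hr.erase hs) (hr.erase_left s) hsr
    rw [hd] at h₁ h₂
    rw [h₁, h₂]

/-- **`δ(κ)_d := v_𝔮(κ_{d,𝔮}) ∈ R`** for any Kolyvagin prime `𝔮 ∤ d` (Def. 8.1; [S21] Def. 5.7),
read in `ℤ/N` through the trivialisation `t_𝔮` and the fixed generators (no `⊗ G_d`); `0` when no
auxiliary prime exists (never the case for the infinite sets `𝒫` of the theory).  Independent of
the choice by `delta_eq`. [cite: Sakamoto2024, Def. 8.1 (p. 937)]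
[cite: Sakamoto2021RankZero, Def. 5.7 (p. 1093)] -/
def delta (D : KolyvaginDatum ρ) (N : ℕ)
    (t : (q : HeightOneSpectrum (𝓞 K)) → SingularQuotient (GaloisRep.toLocal q ρ) →+ ZMod N)
    (κ : Finset (HeightOneSpectrum (𝓞 K)) → HeightOneSpectrum (𝓞 K) → galoisCohomology ρ 1)
    (d : Finset (HeightOneSpectrum (𝓞 K))) : ZMod N :=
  if h : ∃ q, D.IsPair d q then t h.choose (singularLocalization ρ h.choose (κ d h.choose)) else 0

/-- **`δ(κ)_d = v_𝔮(κ_{d,𝔮})` for EVERY `(d, 𝔮) ∈ M`** (well-definedness of Def. 8.1, from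
`trivialised_singularLocalization_eq`). [cite: Sakamoto2024, Def. 8.1 (p. 937)]
[cite: Sakamoto2021RankZero, Def. 5.7 (p. 1093)] -/
theorem IsKolyvaginSystemZero.delta_eq {D : KolyvaginDatum ρ} {N : ℕ}
    {t : (q : HeightOneSpectrum (𝓞 K)) → SingularQuotient (GaloisRep.toLocal q ρ) →+ ZMod N}
    {𝓕 : SelmerStructure ρ}
    {κ : Finset (HeightOneSpectrum (𝓞 K)) → HeightOneSpectrum (𝓞 K) → galoisCohomology ρ 1}
    (hκ : D.IsKolyvaginSystemZero N t 𝓕 κ) {d : Finset (HeightOneSpectrum (𝓞 K))}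
    {q : HeightOneSpectrum (𝓞 K)} (hq : D.IsPair d q) :
    D.delta N t κ d = t q (singularLocalization ρ q (κ d q)) := by
  have h : ∃ q, D.IsPair d q := ⟨q, hq⟩
  rw [delta, dif_pos h]
  exact hκ.trivialised_singularLocalization_eq h.choose_spec hq

/-- `δ` is additive in the system (it is a composite of homomorphisms and an evaluation).
[cite: Sakamoto2021RankZero, Def. 5.7 (p. 1093), "we obtain a homomorphism δ"] -/
theorem delta_add (D : KolyvaginDatum ρ) (N : ℕ)
    (t : (q : HeightOneSpectrum (𝓞 K)) → SingularQuotient (GaloisRep.toLocal q ρ) →+ ZMod N)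
    (κ κ' : Finset (HeightOneSpectrum (𝓞 K)) → HeightOneSpectrum (𝓞 K) → galoisCohomology ρ 1)
    (d : Finset (HeightOneSpectrum (𝓞 K))) :
    D.delta N t (κ + κ') d = D.delta N t κ d + D.delta N t κ' d := by
  unfold delta
  split_ifs with h
  · simp only [Pi.add_apply, map_add]
  · simp

/-- **The homomorphism `δ_d : KS₀(T, 𝓕) → R`, `κ ↦ δ(κ)_d`** ([S21] §2.4 of the Doc. Math. paper and
Def. 5.7: "Hence we obtain a homomorphism `δ : KS₀(T, 𝓕) → ∏_{d ∈ 𝒩} R ⊗_ℤ G_d`"), one level at a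
time. [cite: Sakamoto2024, Def. 8.1 (p. 937)] [cite: Sakamoto2021RankZero, Def. 5.7 (p. 1093)] -/
def deltaHom (D : KolyvaginDatum ρ) (N : ℕ)
    (t : (q : HeightOneSpectrum (𝓞 K)) → SingularQuotient (GaloisRep.toLocal q ρ) →+ ZMod N)
    (𝓕 : SelmerStructure ρ) (d : Finset (HeightOneSpectrum (𝓞 K))) :
    D.kolyvaginSystemsZero N t 𝓕 →+ ZMod N where
  toFun κ := D.delta N t κ.1 d
  map_zero' := by
    change D.delta N t 0 d = 0
    unfold delta
    split_ifs <;> simp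
  map_add' κ κ' := D.delta_add N t κ.1 κ'.1 d

/-- Unfolding `deltaHom`. [cite: Sakamoto2024, Def. 8.1 (p. 937)] -/
@[simp] theorem deltaHom_apply (D : KolyvaginDatum ρ) (N : ℕ)
    (t : (q : HeightOneSpectrum (𝓞 K)) → SingularQuotient (GaloisRep.toLocal q ρ) →+ ZMod N)
    (𝓕 : SelmerStructure ρ) (d : Finset (HeightOneSpectrum (𝓞 K)))
    (κ : D.kolyvaginSystemsZero N t 𝓕) :
    D.deltaHom N t 𝓕 d κ = D.delta N t κ.1 d := rfl

end KolyvaginDatum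

end Literature.NumberTheory.GaloisCohomology

/-! ## F. Pure algebra: `I_S(x) = (x)` for an element of the ring itself -/

namespace Literature.NumberTheory.GaloisCohomology.KolyvaginSystem

/-- For `x ∈ S` regarded in the free rank-one module `S`, **`I_S(x) = (x)`** (Def. 4.2: the values
`f(x)`, `f ∈ Hom_S(S, S)`, are the multiples `f(1)·x`).  This is the unfolding of `I_R(δ(κ)_d)`,
`δ(κ)_d ∈ R ⊗_ℤ G_d ≅ R`, in Thm. 8.5 (3). [cite: Sakamoto2024, Def. 4.2 (p. 926)] -/
theorem idealOfElement_self (S : Type*) [CommRing S] (x : S) :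
    idealOfElement S x = Ideal.span {x} := by
  ext s
  simp only [mem_idealOfElement_iff, Ideal.mem_span_singleton']
  constructor
  · rintro ⟨f, rfl⟩
    exact ⟨f 1, by rw [mul_comm, ← smul_eq_mul, ← map_smul, smul_eq_mul, mul_one]⟩
  · rintro ⟨a, rfl⟩
    exact ⟨a • LinearMap.id, by simp [mul_comm]⟩

end Literature.NumberTheory.GaloisCohomology.KolyvaginSystem

end
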